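import Literature.Topology.FourManifolds.BranchedDoubleCoverCompact
import HarnessLib

/-!
# The orbit space of the deck involution of a branched double cover is `S⁴`

Topic `Literature/Topology/FourManifolds`; theorems about the relational predicate
`IsBranchedDoubleCover IX X K ι q` of `BranchedDoubleCoverTwoKnot.lean`.

Kuhrman, arXiv:2507.03798, §2.2 (and Gompf–Stipsicz (1999), §6.3) describe the 2-knot picture
of the pair `(Σ₂(S⁴, K), ι_K)` by "the quotient `Σ₂(S⁴, K)/ι_K = S⁴`, with the image of the
fixed-point set the 2-knot `K`". For the tree's predicate this reads:

* `IsBranchedDoubleCover.isClosedMap_proj`, `.isQuotientMap_proj` — the projection `q : X → S⁴`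
  is a closed quotient map (`X` is compact, `BranchedDoubleCoverCompact.lean`, `S⁴` Hausdorff);
* `IsBranchedDoubleCover.ker_proj_iff` — the equivalence relation of `q` is "same `ι`-orbit";
* `IsBranchedDoubleCover.exists_orbitSpace_homeomorph` — **the orbit space is `S⁴`**: there is
  a homeomorphism `Φ : X/ι ≃ₜ S⁴` (`X/ι` = the quotient of `X` by the kernel of `q`, i.e. by the
  `ι`-orbits) with `Φ [x] = q x` (a continuous bijection from a compact space to a Hausdorff
  space);
* `IsBranchedDoubleCover.range_eq_preimage_of_fixedPoints`, `.proj_comp_eq_of_fixedPoints` —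
  the fixed-point sphere `e` of `exists_isSmoothEmbedding_fixedPoints` has image exactly
  `q⁻¹(K(S²))`, and `q ∘ e` takes values in the knot.

Everything is a theorem; no named facts.

## References

* J. Kuhrman, arXiv:2507.03798 (2025), §2.2. [Kuhrman2025]
* R. E. Gompf, A. I. Stipsicz, *4-Manifolds and Kirby Calculus* (1999), §6.3. [GompfStipsicz1999]
-/

open scoped Manifold ContDiff Topology
open Function Set

noncomputable section

namespace Literature.Topology.FourManifolds

namespace IsBranchedDoubleCover

variable {EX HX : Type*} [NormedAddCommGroup EX] [NormedSpace ℝ EX] [TopologicalSpace HX]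
  {IX : ModelWithCorners ℝ EX HX} {X : Type*} [TopologicalSpace X] [ChartedSpace HX X]
  {K : TwoKnot} {ι : X → X} {q : X → Metric.sphere (0 : EuclideanSpace ℝ (Fin 5)) 1}

/-- The projection of a branched double cover is a closed map (`X` compact, `S⁴` Hausdorff).
[cite: GompfStipsicz1999, §6.3] -/
theorem isClosedMap_proj (h : IsBranchedDoubleCover IX X K ι q) : IsClosedMap q := by
  haveI := h.compactSpace
  exact h.continuous_proj.isClosedMap

/-- **The projection of a branched double cover is a quotient map** (closed, continuous, onto).
[cite: GompfStipsicz1999, §6.3] -/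
theorem isQuotientMap_proj (h : IsBranchedDoubleCover IX X K ι q) : Topology.IsQuotientMap q :=
  h.isClosedMap_proj.isQuotientMap h.continuous_proj h.proj_surjective

/-- The kernel relation of `q` is "same `ι`-orbit": `q x = q y ↔ y = x ∨ y = ι x`.
[cite: Kuhrman2025, §2.2] -/
theorem ker_proj_iff (h : IsBranchedDoubleCover IX X K ι q) {x y : X} :
    Setoid.ker q x y ↔ y = x ∨ y = ι x := by
  rw [Setoid.ker_def, eq_comm]
  exact h.proj_eq_iff

/-- **The orbit space of the deck involution is `S⁴`**: `q` descends to a homeomorphism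
`X/ι ≃ₜ S⁴`, where `X/ι` is the quotient of `X` by the `ι`-orbits (= the kernel of `q`,
`ker_proj_iff`) — "`Σ₂(S⁴, K)/ι_K = S⁴`" (Kuhrman (2025), §2.2; a continuous bijection from the
compact quotient onto the Hausdorff sphere). [cite: Kuhrman2025, §2.2] -/
theorem exists_orbitSpace_homeomorph (h : IsBranchedDoubleCover IX X K ι q) :
    ∃ Φ : Quotient (Setoid.ker q) ≃ₜ Metric.sphere (0 : EuclideanSpace ℝ (Fin 5)) 1,
      ∀ x, Φ ⟦x⟧ = q x := by
  haveI := h.compactSpace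
  have hcont : Continuous (Setoid.kerLift q) := by
    unfold Setoid.kerLift
    exact h.continuous_proj.quotient_lift _
  have hsurj : Surjective (Setoid.kerLift q) := fun b ↦ by
    obtain ⟨x, rfl⟩ := h.proj_surjective b
    exact ⟨⟦x⟧, Setoid.kerLift_mk q x⟩
  let f : Quotient (Setoid.ker q) ≃ Metric.sphere (0 : EuclideanSpace ℝ (Fin 5)) 1 :=
    Equiv.ofBijective (Setoid.kerLift q) ⟨Setoid.kerLift_injective q, hsurj⟩
  exact ⟨Continuous.homeoOfEquivCompactToT2 (f := f) hcont, fun x ↦ Setoid.kerLift_mk q x⟩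

/-- **The fixed-point sphere lies exactly over the knot**: if `e` parametrises the fixed points
of `ι` (as in `exists_isSmoothEmbedding_fixedPoints`), then `e(S²) = q⁻¹(K(S²))`.
[cite: Kuhrman2025, §2.2] -/
theorem range_eq_preimage_of_fixedPoints (h : IsBranchedDoubleCover IX X K ι q) {S : Type*}
    {e : S → X} (hfix : ∀ x, ι x = x ↔ x ∈ range e) : range e = q ⁻¹' range K := by
  ext x
  rw [← hfix, mem_preimage]
  exact h.isFixedPt_iff x

/-- Over the fixed-point sphere the projection takes values in the knot: `q (e p) ∈ K(S²)`.
[cite: Kuhrman2025, §2.2] -/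
theorem proj_apply_mem_range_of_fixedPoints (h : IsBranchedDoubleCover IX X K ι q) {S : Type*}
    {e : S → X} (hfix : ∀ x, ι x = x ↔ x ∈ range e) (p : S) : q (e p) ∈ range K :=
  (h.isFixedPt_iff (e p)).1 ((hfix (e p)).2 ⟨p, rfl⟩)

end IsBranchedDoubleCover

end Literature.Topology.FourManifolds
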